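import Summits.ResolutionOfSingularities.ResolutionOfSingularities.Theorems.FrobeniusClosingSteerGeoDictQuadratic
import Literature.AlgebraicGeometry.Resolution.LocalBlowup
import Literature.AlgebraicGeometry.Resolution.QuadraticTransforms
import Mathlib.RingTheory.AdjoinRoot
import Mathlib.Algebra.CharP.Lemmas
import HarnessLib

/-!
# Thread chains, part 1: identity steps and unit rescaling (THREAD piece of the σ-residual HIGH half at `p = 2`)

W4.1, crux `Steer` (stmt-ResolutionOfSingularities-16345), σ-line, §σ2.21 HIGH-WANDER FOREST (res-L0-w41-strat-2 delta rev 13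
c7828a1d38db410e; res-L0-w41-plan-1 RULINGS 14d/15a: `ThreadWanderTwoN` → res-D-pv-011 AS res-L0-w41-stub-7). Along an infinite
THREAD `j₀ < j₁ < ⋯` of centres (`P jₖ` contracts onto `P jᵢ` with equal heights) put `W m := P j ∩ R m` for the next visit `j ≥ m`.
A stage `m` strictly between two visits is an IDENTITY STEP for the thread germ when the centre `V(P m)` does not contain the thread
variety `V(W m)`, i.e. `¬ P m ≤ W m`. This file (Theses-free, def-free; the chain rings in the def-free `locChar` interface of
`FrobeniusClosingSteerGeoDictQuadratic.lean`: `hT : ∀ z, z ∈ T ↔ ∃ a b : R, b ∉ W ∧ z = a / b`, «`T = R_W` inside `K`») proves: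

* `not_mem_of_not_le` — at an identity step the exceptional parameter `x` of the centre is NOT in `W m` (a prime of the chart
  `R[P/x]` containing `x` contains `P = x · (P/x)`);
* `locChar_eq_of_not_le` — at an identity step the germ does not move: `(R (m+1))_{W (m+1)} = (R m)_{W m}` as subrings of `K`
  (the chart lies in `R_W` because `x` is a unit there, and value-one denominators are units of `R (m+1)`, hence outside `W (m+1)`);
* `isRegularLocalRing_adjoinRoot_rescale` — in characteristic `p`, `S[T]/(T^p − f) ≅ S[T]/(T^p − (u^p f + w^p))` for a unit `u`
  (`T ↦ uT + w`), so regularity of one radicand ring gives the other (the radicand of the thread germ changes by exactly such a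
  rescaling across identity steps: `s m = x · s (m+1) + g` with `x` a unit of the germ).

Part 2 assembles the eternal isolated radicand chain of a finitely-hit thread (Ĝ = G10 `GeoDict.not_noEternalChain_of_dominantTail`
p503815 with identity steps). OURS (the W4.1 engine); standard commutative algebra.
[cite: NovacoskiSpivakovsky2014, Def. 2.11] [cite: Cutkosky2014, §2.1] [cite: Matsumura1987, Thm. 14.2]
-/

noncomputable section

-- `Summit.<S>.<S>.…` duplicates the summit name by design (single-problem summit).
set_option linter.dupNamespace false

open Polynomial IsLocalRing Literature.AlgebraicGeometry.Resolution

namespace Summit.ResolutionOfSingularities.ResolutionOfSingularities.Theorems.SwitchingDichotomy.ThreadChain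

universe u

variable {K : Type u} [Field K]

/-! ## §1 Identity steps -/

section Identity

variable {O : ValuationSubring K} {R R' : Subring K} {P W : Ideal R} {W' : Ideal R'}
  (hle : R ≤ R') (hcomap : W'.comap (Subring.inclusion hle) = W)

include hcomap in
/-- **The exceptional parameter avoids the thread prime at an identity step.** If `W' ∩ R = W`, every `y ∈ P` satisfies
`y / x ∈ R'` (the `x`-chart of the centre `P` lies in `R'`), `x ∈ P` and `P ⊄ W`, then `x ∉ W`: otherwise `x ∈ W'` and
`y = x · (y/x) ∈ W'` for all `y ∈ P`, i.e. `P ≤ W`. [cite: Cutkosky2014, §2.1] [folklore] -/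
theorem not_mem_of_not_le [W'.IsPrime] {x : K} (hxR : x ∈ R) (hx0 : x ≠ 0)
    (hdiv : ∀ y : R, y ∈ P → (y : K) / x ∈ R') (hPW : ¬ P ≤ W) : (⟨x, hxR⟩ : R) ∉ W := by
  intro hxW
  apply hPW
  intro y hy
  rw [← hcomap, Ideal.mem_comap]
  have hxW' : (⟨x, hle hxR⟩ : R') ∈ W' := by
    have := hxW
    rw [← hcomap, Ideal.mem_comap] at this
    exact this
  have hprod : Subring.inclusion hle y = ⟨x, hle hxR⟩ * ⟨(y : K) / x, hdiv y hy⟩ := by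
    apply Subtype.ext
    change ((y : R) : K) = x * ((y : K) / x)
    rw [mul_div_cancel₀ _ hx0]
  rw [hprod]
  exact W'.mul_mem_right _ hxW'

include hcomap in
/-- **The germ does not move at an identity step**: `(R')_{W'} = R_W` inside `K`. Here `R' = (C)_{𝔪_O ∩ C}` for a subring `C`
(the chart of the centre) contained in `R_W` — which is the case when the exceptional parameter is outside `W`
(`not_mem_of_not_le`) — and `W' ∩ R = W`. Proof: `R_W ⊆ (R')_{W'}` by `W' ∩ R = W`; conversely an element of `R_W ∩ R'`
outside `W'` is `a/b` with `a, b ∉ W`, so its inverse lies in `R_W`; value-one elements of `C` are units of `R'`, hence outside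
`W'`; so `R' ⊆ R_W` and `(R')_{W'} ⊆ R_W`. [cite: NovacoskiSpivakovsky2014, Def. 2.8] [folklore] -/
theorem locChar_eq_of_le [W.IsPrime] [W'.IsPrime] {T T' C : Subring K}
    (hT : ∀ z : K, z ∈ T ↔ ∃ a b : R, b ∉ W ∧ z = (a : K) / b)
    (hT' : ∀ z : K, z ∈ T' ↔ ∃ a b : R', b ∉ W' ∧ z = (a : K) / b)
    (hR' : R' = locAtCentre C O) (hCT : C ≤ T) : T' = T := by
  -- an element of `R' ∩ R_W` outside `W'` has its inverse in `R_W`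
  have hinv : ∀ z : K, z ∈ T → ∀ hz' : z ∈ R', (⟨z, hz'⟩ : R') ∉ W' → z⁻¹ ∈ T := by
    intro z hzT hz' hzW'
    obtain ⟨a, b, hb, rfl⟩ := (hT z).mp hzT
    have ha : a ∉ W := by
      intro haW
      have haW' : Subring.inclusion hle a ∈ W' := by
        rw [← hcomap, Ideal.mem_comap] at haW; exact haW
      have hbW' : Subring.inclusion hle b ∉ W' := by
        rw [← hcomap, Ideal.mem_comap] at hb; exact hb
      have hprod : Subring.inclusion hle a = ⟨(a : K) / b, hz'⟩ * Subring.inclusion hle b := by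
        apply Subtype.ext
        change ((a : R) : K) = (a : K) / b * b
        rw [div_mul_cancel₀ _ (GeoDict.coe_ne_zero_of_not_mem hb)]
      rw [hprod] at haW'
      rcases (‹W'.IsPrime›.mem_or_mem haW') with h | h
      · exact hzW' h
      · exact hbW' h
    rw [inv_div]
    exact (hT _).mpr ⟨b, a, ha, rfl⟩
  -- `R' ⊆ R_W`
  have hR'T : R' ≤ T := by
    intro z hz
    have hz' := hz
    rw [hR'] at hz'
    obtain ⟨c, hc, d, hd, hvd, rfl⟩ := hz'
    have hdT : d ∈ T := hCT hd
    have hd0 : d ≠ 0 := ne_zero_of_valuation_eq_one hvd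
    have hdR' : d ∈ R' := by rw [hR']; exact le_locAtCentre C O hd
    have hdinvR' : d⁻¹ ∈ R' := by rw [hR']; exact inv_mem_locAtCentre (le_locAtCentre C O hd) hvd
    have hdW' : (⟨d, hdR'⟩ : R') ∉ W' := by
      intro h
      have hunit : IsUnit (⟨d, hdR'⟩ : R') :=
        (isUnit_subring_iff_inv_mem _).mpr ⟨hd0, hdinvR'⟩
      exact ‹W'.IsPrime›.ne_top (W'.eq_top_of_isUnit_mem h hunit)
    rw [div_eq_mul_inv]
    exact T.mul_mem (hCT hc) (hinv d hdT hdR' hdW')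
  apply le_antisymm
  · intro z hz
    obtain ⟨a, b, hb, rfl⟩ := (hT' z).mp hz
    rw [div_eq_mul_inv]
    exact T.mul_mem (hR'T a.2) (hinv (b : K) (hR'T b.2) b.2 hb)
  · exact GeoDict.le_of_locChar_of_comap hle hcomap hT hT'

end Identity

/-- **The chart of the centre lies in `R_W` when its exceptional parameter is outside `W`.** [folklore] -/
theorem closure_le_of_not_mem {R T : Subring K} {W : Ideal R} [W.IsPrime]
    (hT : ∀ z : K, z ∈ T ↔ ∃ a b : R, b ∉ W ∧ z = (a : K) / b) {x : R} (hxW : x ∉ W) (u : Set R) :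
    Subring.closure ((R : Set K) ∪ (fun y : R => (y : K) / (x : K)) '' u) ≤ T := by
  refine Subring.closure_le.mpr ?_
  rintro z (hz | ⟨y, -, rfl⟩)
  · exact GeoDict.le_of_locChar hT hz
  · exact (hT _).mpr ⟨y, x, hxW, rfl⟩

/-! ## §2 Unit rescaling of the radicand -/

/-- **`S[T]/(T^p − f) ≅ S[T]/(T^p − (u^p·f + w^p))` for a unit `u` in characteristic `p`** (`T ↦ u·T + w`): regularity
transfers. OURS bookkeeping. [folklore] -/
theorem isRegularLocalRing_adjoinRoot_rescale {S : Type u} [CommRing S] (p : ℕ) [Fact p.Prime] [CharP S p]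
    {u w f f' : S} (hu : IsUnit u) (hf' : f' = u ^ p * f + w ^ p)
    (h : IsRegularLocalRing (AdjoinRoot (X ^ p - C f : S[X]))) :
    IsRegularLocalRing (AdjoinRoot (X ^ p - C f' : S[X])) := by
  obtain ⟨v, hv⟩ := hu.exists_left_inv
  set F : S[X] := X ^ p - C f with hF
  set F' : S[X] := X ^ p - C f' with hF'
  -- `root_F ^ p = f`, `root_F' ^ p = f'`
  have hrootF : AdjoinRoot.mk F (X ^ p) = AdjoinRoot.of F f := by
    have h0 : AdjoinRoot.mk F (X ^ p - C f) = 0 := by rw [← hF]; exact AdjoinRoot.mk_self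
    rw [map_sub, sub_eq_zero, AdjoinRoot.mk_C] at h0
    exact h0
  have hrootF' : AdjoinRoot.mk F' (X ^ p) = AdjoinRoot.of F' f' := by
    have h0 : AdjoinRoot.mk F' (X ^ p - C f') = 0 := by rw [← hF']; exact AdjoinRoot.mk_self
    rw [map_sub, sub_eq_zero, AdjoinRoot.mk_C] at h0
    exact h0
  -- the images of the roots: `a = u·T + w` in `S[T]/(F)`, `b = v·(T − w)` in `S[T]/(F')`
  set a : AdjoinRoot F := AdjoinRoot.mk F (C u * X + C w) with ha
  set b : AdjoinRoot F' := AdjoinRoot.mk F' (C v * (X - C w)) with hb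
  have hapow : a ^ p = AdjoinRoot.of F f' := by
    rw [ha, ← map_pow, add_pow_char, mul_pow, ← C_pow, ← C_pow, map_add, map_mul, AdjoinRoot.mk_C,
      AdjoinRoot.mk_C, hrootF, hf', map_add, map_mul]
  have hbpow : b ^ p = AdjoinRoot.of F' f := by
    rw [hb, ← map_pow, mul_pow, sub_pow_char, ← C_pow, ← C_pow, map_mul, map_sub, AdjoinRoot.mk_C,
      AdjoinRoot.mk_C, hrootF', hf', map_add, map_mul, map_pow, map_pow, map_pow]
    have hvu : AdjoinRoot.of F' v ^ p * AdjoinRoot.of F' u ^ p = 1 := by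
      rw [← mul_pow, ← map_mul, hv, map_one, one_pow]
    linear_combination (AdjoinRoot.of F' f) * hvu
  have haev : F'.eval₂ (algebraMap S (AdjoinRoot F)) a = 0 := by
    rw [hF', eval₂_sub, eval₂_X_pow, eval₂_C, hapow, AdjoinRoot.algebraMap_eq, sub_self]
  have hbev : F.eval₂ (algebraMap S (AdjoinRoot F')) b = 0 := by
    rw [hF, eval₂_sub, eval₂_X_pow, eval₂_C, hbpow, AdjoinRoot.algebraMap_eq, sub_self]
  let φ : AdjoinRoot F' →ₐ[S] AdjoinRoot F := AdjoinRoot.liftAlgHom F' (Algebra.ofId S _) a haev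
  let ψ : AdjoinRoot F →ₐ[S] AdjoinRoot F' := AdjoinRoot.liftAlgHom F (Algebra.ofId S _) b hbev
  have hφroot : φ (AdjoinRoot.root F') = a := AdjoinRoot.liftAlgHom_root _ _ _ _
  have hψroot : ψ (AdjoinRoot.root F) = b := AdjoinRoot.liftAlgHom_root _ _ _ _
  have hφof : ∀ r : S, φ (AdjoinRoot.of F' r) = AdjoinRoot.of F r := fun r => AdjoinRoot.liftAlgHom_of _ _ _ _ r
  have hψof : ∀ r : S, ψ (AdjoinRoot.of F r) = AdjoinRoot.of F' r := fun r => AdjoinRoot.liftAlgHom_of _ _ _ _ r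
  have ha' : a = AdjoinRoot.of F u * AdjoinRoot.root F + AdjoinRoot.of F w := by
    rw [ha, map_add, map_mul, AdjoinRoot.mk_C, AdjoinRoot.mk_C, AdjoinRoot.mk_X]
  have hb' : b = AdjoinRoot.of F' v * (AdjoinRoot.root F' - AdjoinRoot.of F' w) := by
    rw [hb, map_mul, map_sub, AdjoinRoot.mk_C, AdjoinRoot.mk_C, AdjoinRoot.mk_X]
  have hφψ : φ.comp ψ = AlgHom.id S _ := by
    refine AdjoinRoot.algHom_ext ?_
    rw [AlgHom.comp_apply, AlgHom.id_apply, hψroot, hb', map_mul, map_sub, hφof, hφof, hφroot, ha']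
    have : AdjoinRoot.of F v * AdjoinRoot.of F u = 1 := by rw [← map_mul, hv, map_one]
    linear_combination (AdjoinRoot.root F) * this
  have hψφ : ψ.comp φ = AlgHom.id S _ := by
    refine AdjoinRoot.algHom_ext ?_
    rw [AlgHom.comp_apply, AlgHom.id_apply, hφroot, ha', map_add, map_mul, hψof, hψof, hψroot, hb']
    have : AdjoinRoot.of F' u * AdjoinRoot.of F' v = 1 := by rw [← map_mul, mul_comm, hv, map_one]
    linear_combination (AdjoinRoot.root F' - AdjoinRoot.of F' w) * this
  let e : AdjoinRoot F ≃ₐ[S] AdjoinRoot F' := AlgEquiv.ofAlgHom ψ φ hψφ hφψ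
  haveI := h
  exact IsRegularLocalRing.of_ringEquiv e.toRingEquiv

end Summit.ResolutionOfSingularities.ResolutionOfSingularities.Theorems.SwitchingDichotomy.ThreadChain

end
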